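import Summits.RiemannHypothesis.RiemannHypothesis.Theses.SignCone
import Summits.RiemannHypothesis.RiemannHypothesis.Theorems.SignConeConeMagnificationCompactness
import Summits.RiemannHypothesis.RiemannHypothesis.Theorems.SignConeConeMagnificationStubFakePNT
import Summits.RiemannHypothesis.RiemannHypothesis.Theorems.SignConeConeMagnificationStubChebyshev
import Summits.RiemannHypothesis.RiemannHypothesis.Theorems.SignConeConeMagnificationStubContinuation
import Summits.RiemannHypothesis.RiemannHypothesis.Theorems.SignConeConeMagnificationStubTransfer
import Summits.RiemannHypothesis.RiemannHypothesis.Theorems.SignConeConeMagnificationStubPdLaplace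
import Summits.RiemannHypothesis.RiemannHypothesis.Theorems.SignConeConeMagnificationStubCara
import Summits.RiemannHypothesis.RiemannHypothesis.Theorems.SignConeConeMagnificationStubDeficitOfDesign
import Literature.NumberTheory.LFunctions.WeilExplicit
import Literature.NumberTheory.LFunctions.GeneralizedRH

/-!
# `SignCone.ConeMagnification` — line `zero_free_split` (strategist), r2
(item stmt-RiemannHypothesis-16303, route route-RiemannHypothesis-SignCone; unit
`cstrat-stmt-RiemannHypothesis-16303-r1`; line card `Lines/zero_free_split.md`; WORKFILE — not the registered
skeleton: the registered skeleton is the lead's `Lines/Sketch.lean` r6, left untouched)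

CRUX: if at every cutoff `a > 0` some weight `c_a ≥ 0` on `ℕ` (`c_a 1 = 0`) has unit slack
`-‖g‖₂² ≤ Re (W_ar(g ⋆ g̃) − P_{c_a}(g ⋆ g̃))` for all Weil tests `g` supported in `[-a, a]`, then RH.
The crux is implied by RH (`Disproof.lean` §A), which is why the route re-audit binned it RESTATED.  This file is
the decomposition that answers the audit, in the state of the tree at 2026-08-17T02:20Z: EIGHT LANDED theorems
(slack-cone compactness p129201, fake PNT p130740, Chebyshev p131015, continuation p130893, Laplace positivity
p132066, Carathéodory majorant p133591, the finite design spine `stub_deficitOfDesign` p137772, Landau transfer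
p130783) and TWO stubs, NEITHER of which mentions a zero of `ζ` on or off the line as a hypothesis, RH, or `¬RH`:

* `stub_combZeroSide` (c-FREE, unconditional; verbatim the lead's registered r6 stub) — ζ-MOLLIFIED resonator
  combs are Weil-neutral: `|Re(W_ar(K) − P_Λ(K))| ≤ ε‖g‖₂²` for `κ = (log M)^θ`, `M ≥ M₀`.  A theorem about the
  TRUE explicit formula (zeros of any real part are mollified alike): AFE truncation with uniform error, smooth
  mean value theorem, Gallagher, zero counting.  Provable now (lead: infrastructure `WeilLogLatticeComb` p137910).
* `stub_designOfSlackComb` (THE OPEN CORE; the lead's r6 `stub_designOfOffline` with its first hypothesis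
  `¬ RiemannHypothesis` DELETED) — comb zero-side lemma + a weight `c ≥ 0`, `c 1 = 0` with unit slack against
  every Weil test (+ `L`-summability on `re s > 1`, + Carathéodory majorant) ⇒ the 2001 design data AX-A ∧ AX-B ∧
  AX-C at `M = 1` (W-MAG Thm 3.1 / prop:abs / eq:LO, stated and internally refereed for EVERY cone member, RH
  world included).  Without `¬RH` the stub is no longer "≡ False under its hypotheses": it has independent
  content (design data for the exotic infinite-support members of the uniform cone that exist under RH), so it
  is neither RH restated nor the crux restated — cheap probes `→ RH`, `→ ConeMagnification` and their converses
  fail (strategist folder `bc/`).  A proof of it gives the lead's stub by `fun hRH => …`; the `¬RH` ammunition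
  (pole of `F + ζ'/ζ + 1/(s−1)` at `ρ₀`, common abscissa `σ*`) stays available inside a proof of the lead's form.

`ConeMagnification_of` = `coneMagnification_of_uniform` ∘ (fakePNT → chebyshev → continuation; pdLaplace → cara;
designOfSlackComb(combZeroSide); deficitOfDesign [LANDED]; transfer).  No `by_cases RiemannHypothesis`.
ROUTE-LEVEL READING (SPLIT-PROPOSAL.md): the natural route child is `SlackDesign` := the statement of
`stub_designOfSlackComb` without the comb hypothesis (unit slack ⇒ design data; Mathlib primitives; children.json),
with `ConeMagnification_of_subs : SlackDesign → DeficitOfDesign → ConeMagnification` certified (Split.lean,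
evidence) and `DeficitOfDesign` = `stub_deficitOfDesign` now landed: modulo landed theorems the crux is ONE
zero-free statement strictly stronger than itself.
-/

noncomputable section

-- `Summit.RiemannHypothesis.RiemannHypothesis.…` repeats a namespace component by design (D-0017 layout).
set_option linter.dupNamespace false

open scoped BigOperators ComplexConjugate Topology
open Complex MeasureTheory Set Filter

namespace Summit.RiemannHypothesis.RiemannHypothesis.Cruxes.ConeMagnification.ZeroFreeSplit

open Literature.NumberTheory.LFunctions
open Summit.RiemannHypothesis.RiemannHypothesis.Theorems.SignCone
open Summit.RiemannHypothesis.RiemannHypothesis.Theorems.SignConeConeMagnification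
open Summit.RiemannHypothesis.RiemannHypothesis.Cruxes.ConeMagnification.Sketch

/-! ### The stubs (signatures over existing declarations only) -/

/-- **Stub Z — `combZeroSide`** (c-free, unconditional; verbatim the lead's registered stub of line `Sketch` r6):
ζ-mollified resonator combs are Weil-neutral. [folklore] -/
theorem stub_combZeroSide :
    ∀ α : ℕ → ℝ, ∀ L : ℕ, (∀ m, L < m → α m = 0) →
      ∀ b₁ : ℝ → ℂ, IsWeilTest b₁ → tsupport b₁ ⊆ Set.Icc (-1) 1 →
      ∀ θ : ℝ, 0 < θ → θ < 1 → ∀ ε : ℝ, 0 < ε → ∃ M₀ : ℕ, ∀ M : ℕ, M₀ ≤ M →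
        let κ : ℝ := Real.log M ^ θ
        let g : ℝ → ℂ := fun u => ∑ m ∈ Finset.range (L * M + 1),
          ((∑ k ∈ (Nat.divisors m).filter (· ≤ M), α (m / k) / Real.sqrt k : ℝ) : ℂ) *
            b₁ ((u - Real.log m) * (M : ℝ) / κ)
        |(weilPolarTerm (weilConv g (weilReflect g)) + weilArchTerm (weilConv g (weilReflect g)) -
            ∑' n : ℕ, ((ArithmeticFunction.vonMangoldt n : ℝ) : ℂ) / (Real.sqrt n : ℂ) *
              (weilConv g (weilReflect g) (Real.log n) + weilConv g (weilReflect g) (-Real.log n))).re| ≤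
          ε * ∫ u, ‖g u‖ ^ 2 := by
  sorry

/-- **Stub D — `designOfSlackComb`** (THE OPEN CORE; the lead's `stub_designOfOffline` with the hypothesis `¬RH`
deleted, everything else verbatim): comb zero-side lemma + a unit-slack weight `c ≥ 0`, `c 1 = 0`
(+ `L`-summability on `re s > 1`, + Carathéodory majorant) ⇒ design data AX-A ∧ AX-B ∧ AX-C at `M = 1`. [folklore] -/
theorem stub_designOfSlackComb :
    (∀ α : ℕ → ℝ, ∀ L : ℕ, (∀ m, L < m → α m = 0) →
      ∀ b₁ : ℝ → ℂ, IsWeilTest b₁ → tsupport b₁ ⊆ Set.Icc (-1) 1 →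
      ∀ θ : ℝ, 0 < θ → θ < 1 → ∀ ε : ℝ, 0 < ε → ∃ M₀ : ℕ, ∀ M : ℕ, M₀ ≤ M →
        let κ : ℝ := Real.log M ^ θ
        let g : ℝ → ℂ := fun u => ∑ m ∈ Finset.range (L * M + 1),
          ((∑ k ∈ (Nat.divisors m).filter (· ≤ M), α (m / k) / Real.sqrt k : ℝ) : ℂ) *
            b₁ ((u - Real.log m) * (M : ℝ) / κ)
        |(weilPolarTerm (weilConv g (weilReflect g)) + weilArchTerm (weilConv g (weilReflect g)) -
            ∑' n : ℕ, ((ArithmeticFunction.vonMangoldt n : ℝ) : ℂ) / (Real.sqrt n : ℂ) *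
              (weilConv g (weilReflect g) (Real.log n) + weilConv g (weilReflect g) (-Real.log n))).re| ≤
          ε * ∫ u, ‖g u‖ ^ 2) →
    ∀ c : ℕ → ℝ, (∀ n, 0 ≤ c n) → c 1 = 0 →
      (∀ g : ℝ → ℂ, IsWeilTest g →
        -(∫ t, ‖g t‖ ^ 2) ≤
          (weilPolarTerm (weilConv g (weilReflect g)) + weilArchTerm (weilConv g (weilReflect g)) -
            ∑' n : ℕ, ((c n : ℝ) : ℂ) / (Real.sqrt n : ℂ) *
              (weilConv g (weilReflect g) (Real.log n) + weilConv g (weilReflect g) (-Real.log n))).re) →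
      (∀ σ : ℝ, 1 < σ → LSeriesSummable (fun n => ((c n : ℝ) : ℂ)) σ) →
      (∃ F : ℂ → ℂ, DifferentiableOn ℂ F {s : ℂ | 1 / 2 < s.re} ∧
        (∀ s : ℂ, 1 < s.re → F s = LSeries (fun n => ((c n : ℝ) : ℂ)) s - 1 / (s - 1)) ∧
        ∀ s : ℂ, 1 / 2 < s.re →
          (F s).re ≤ 1 / 2 + (1 / s).re +
            1 / (2 * Real.pi) * (∫ v : ℝ, (Complex.digamma (1 / 4 + v / 2 * Complex.I)).re *
              ((s.re - 1 / 2) / ((s.re - 1 / 2) ^ 2 + (s.im - v) ^ 2))) - Real.log Real.pi / 2) →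
      Summable (fun n : ℕ => |c n - ArithmeticFunction.vonMangoldt n| / (n : ℝ)) ∧
      Summable (fun n : ℕ => if 2 ≤ n ∧ ¬ IsPrimePow n then
        c n / (n : ℝ) * (∑ q ∈ n.primeFactors, ∑ q' ∈ n.primeFactors.filter (fun q' => q < q'),
          ((Real.sqrt q - 1) / 2) * ((Real.sqrt q' - 1) / 2)) else 0) ∧
      (∀ S : Finset ℕ, (∀ p ∈ S, p.Prime) → ∀ a : ℕ → ℝ, (∀ p ∈ S, 0 ≤ a p ∧ a p ≤ 1) → ∀ φ : ℝ,
        (∑' n : ℕ, (c n - ArithmeticFunction.vonMangoldt n) / (n : ℝ) *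
          (if ∀ p ∈ S, ¬ (p ^ 2 ∣ n) then
            Real.sqrt (∏ p ∈ S.filter (· ∣ n), (p : ℝ)) * (∏ p ∈ S.filter (· ∣ n), a p) *
              (1 / 2) ^ (S.filter (· ∣ n)).card * Real.cos (((S.filter (· ∣ n)).card : ℝ) * φ)
          else 0)) ≤ 1 / 2) := by
  sorry

/-! ### The composition (sorry-free glue; concludes the crux BY NAME) -/

/-- **`SignCone.ConeMagnification` from the two zero-free stubs and eight landed theorems.** [folklore] -/
theorem ConeMagnification_of :
    Summit.RiemannHypothesis.RiemannHypothesis.Theses.SignCone.ConeMagnification := by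
  refine coneMagnification_of_uniform ?_
  rintro ⟨c, hc0, hc1, hU⟩
  -- fake PNT with O(1) error, Chebyshev (σ > 1), continuation of `L_c − 1/(s−1)` to `re s > 1/2`
  have hPNT := stub_fakePNT c hc0 hU
  have hsum := stub_chebyshev c hc0 hPNT
  have hcont := stub_continuation c hc0 hPNT hsum
  -- Laplace positivity and the Carathéodory majorant
  have hPD := stub_pdLaplace c hc0 hU
  have hF := stub_cara c hc0 hc1 hU hsum hcont hPD
  -- the c-free comb lemma feeds the core: design data
  obtain ⟨hA, hB, hC⟩ := stub_designOfSlackComb stub_combZeroSide c hc0 hc1 hU hsum hF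
  -- finite design spine (LANDED p137772): prime-deficit summability for σ > 1/2
  have hdef := stub_deficitOfDesign c hc0 hc1 hA hB hC
  -- Landau transfer
  exact stub_transfer c hc0 hsum hcont hdef

end Summit.RiemannHypothesis.RiemannHypothesis.Cruxes.ConeMagnification.ZeroFreeSplit

end
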